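import Literature.Probability.Percolation.TripodExchange
import Summits.CriticalPhenomena.PercolationContinuityZ3.Theorems.PercNearOneGluingNoHeavyLowerTailFatMinorityCounting
import HarnessLib

/-!
# `NoHeavyLowerTail` (stmt-CriticalPhenomena-4575), line fat-minority-linear — the DOMINANT-RELAY
# class of the stub `stub_fatMinorityLinear`, via van den Berg–Häggström–Kahn's negative
# correlation of two disjoint clusters (BHK 2006, Thm. 1.4, proved in the tree)

Relay set `A`, observer `o ∉ A`, `N = #{a ∈ A : o ↔ a}`, `η ≥ max_{a,a'} P(a ↮ a')`.  A relay
`a₀ ∈ A` is *`θ`-dominant* for `o` if `P(o ↔ A, o ↮ a₀) ≤ θ · P(o ↮ a₀)`, i.e. missing `a₀` is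
at most `1/(1−θ)` times as likely as missing the whole relay set (for `θ = 1/4`:
`P(o ↮ a₀) ≤ (4/3) P(o ↮ A)`).  This is a probabilistic, non-geometric hypothesis, transversal to
the geometric classes already closed (bounded `|A|`, no-majority, star-attached observers, pockets
of bounded depth).

* `reachSet_openConn_negCorr` — BHK 2006 Thm. 1.4 with `f = 1{o ↔ A}` (increasing in `C_o`) and
  `g = 1{a₀ ↔ a}` (increasing in `C_{a₀}`): `μ(D) μ(D ∩ {o↔A} ∩ {a₀↔a}) ≤ μ(D ∩ {o↔A}) μ(D ∩ {a₀↔a})`,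
  `D = {o ↮ a₀}` — "given that `o` misses `a₀`, reaching the relay set and `a₀`'s cluster being
  large are negatively correlated".
* `fatMinority_dominantRelay` — **the stub on the dominant-relay class**: if `a₀ ∈ A` is
  `θ`-dominant with `2θ < 1` then
  `(1 − 2θ) · P(1 ≤ N ∧ 2N ≤ |A|) ≤ 2η + 4θη + 2θ · P(o ↮ A)`;
  `fatMinority_dominantRelay_quarter` — `θ = 1/4`: `P(d₀ < N ∧ 2N ≤ |A|) ≤ 6η + P(o ↮ A)`.

Proof.  Either `a₀` misses at least half of the relays (probability `≤ 2η` by counting), or the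
cluster of `a₀` holds a strict majority; in the latter case an observer in the minority misses
`a₀`, and by BHK (summed over `a ∈ A`, then Markov at `|A|/2`)
`P(o ↔ A, o ↮ a₀, a₀ majority) ≤ (2/|A|) Σ_a μ(D ∩ {o↔A} ∩ {a₀↔a}) ≤ (2θ/|A|) Σ_a P(o ↮ a)`,
while `Σ_a P(o ↮ a) ≤ |A| (P(o ↮ A) + P(1 ≤ N ≤ |A|/2) + 2η)` (Harris–Markov tail `nhlts_tail`);
absorb.  No new definitions; BHK enters through the landed
`BHK2006_twoClusterConditionalAssociation_holds`.
-/

noncomputable section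

namespace Summit.CriticalPhenomena.PercolationContinuityZ3.Theorems

open MeasureTheory Set Literature.Probability.LatticeModels Literature.Probability.Percolation
open Literature.Probability.Percolation.TripodExchange
open scoped Classical BigOperators

/-- **BHK 2006, Thm. 1.4, for the reach of the relay set and one connection of `a₀`.**  With
`D = {o ↮ a₀}`, `U = {o ↔ A}` and `M = {a₀ ↔ a}`:
`μ(D) · μ(D ∩ (U ∩ M)) ≤ μ(D ∩ U) · μ(D ∩ M)` (`1_U` is an increasing function of the edge cluster
of `o`, `1_M` of that of `a₀`). [cite: VandenbergHaggstromKahn2005, Thm. 1.4 (p. 7)] -/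
theorem reachSet_openConn_negCorr {n : ℕ} (w : Sym2 (Fin n) → unitInterval) (A : Finset (Fin n))
    (o a₀ a : Fin n) (hne : o ≠ a₀) :
    (prodBernoulli w).real (openConn o a₀ : Set (BondConfig (Fin n)))ᶜ *
        (prodBernoulli w).real ((openConn o a₀ : Set (BondConfig (Fin n)))ᶜ ∩
          ((⋃ a' ∈ A, (openConn o a' : Set (BondConfig (Fin n)))) ∩
            (openConn a₀ a : Set (BondConfig (Fin n))))) ≤
      (prodBernoulli w).real ((openConn o a₀ : Set (BondConfig (Fin n)))ᶜ ∩
          (⋃ a' ∈ A, (openConn o a' : Set (BondConfig (Fin n))))) *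
        (prodBernoulli w).real ((openConn o a₀ : Set (BondConfig (Fin n)))ᶜ ∩
          (openConn a₀ a : Set (BondConfig (Fin n)))) := by
  -- `F(C) = 1{some relay is o or touches an edge of C}`: increasing, and `F(C_o ω) = 1_U(ω)`
  have hFmono : Monotone (fun C : Set (Sym2 (Fin n)) =>
      if ∃ a' ∈ A, (a' = o ∨ ∃ e ∈ C, a' ∈ e) then (1 : ℝ) else 0) := by
    intro C C' hCC'
    dsimp only
    by_cases h : ∃ a' ∈ A, (a' = o ∨ ∃ e ∈ C, a' ∈ e)
    · have h' : ∃ a' ∈ A, (a' = o ∨ ∃ e ∈ C', a' ∈ e) := by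
        obtain ⟨a', ha', h⟩ := h
        exact ⟨a', ha', h.imp id fun ⟨e, he, hae⟩ => ⟨e, hCC' he, hae⟩⟩
      rw [if_pos h, if_pos h']
    · rw [if_neg h]
      split_ifs
      · exact zero_le_one
      · exact le_rfl
  have hFval : ∀ ω : BondConfig (Fin n),
      (if ∃ a' ∈ A, (a' = o ∨ ∃ e ∈ openEdgeCluster ω o, a' ∈ e) then (1 : ℝ) else 0) =
        (⋃ a' ∈ A, (openConn o a' : Set (BondConfig (Fin n)))).indicator 1 ω := by
    intro ω
    by_cases hU : ω ∈ ⋃ a' ∈ A, (openConn o a' : Set (BondConfig (Fin n)))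
    · rw [Set.indicator_of_mem hU, Pi.one_apply, if_pos]
      obtain ⟨a', ha', h⟩ := Set.mem_iUnion₂.1 hU
      exact ⟨a', ha', (reachable_iff_exists_mem_openEdgeCluster ω o a').1 h⟩
    · rw [Set.indicator_of_notMem hU, if_neg]
      rintro ⟨a', ha', h⟩
      exact hU (Set.mem_iUnion₂.2 ⟨a', ha', (reachable_iff_exists_mem_openEdgeCluster ω o a').2 h⟩)
  have key := BHK2006_twoClusterConditionalAssociation_holds.negCorrelation (Fin n) w o a₀
    (fun C : Set (Sym2 (Fin n)) => if ∃ a' ∈ A, (a' = o ∨ ∃ e ∈ C, a' ∈ e) then (1 : ℝ) else 0)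
    (connIndicatorFn a₀ a) hFmono (monotone_connIndicatorFn a₀ a) hne
  have hD : {ω : BondConfig (Fin n) | ¬ (openGraph ω).Reachable o a₀} =
      (openConn o a₀ : Set (BondConfig (Fin n)))ᶜ := rfl
  simp only [hD, hFval, connIndicatorFn_openEdgeCluster] at key
  simp only [setIntegral_indicator_one_eq, setIntegral_indicator_mul_indicator_eq] at key
  exact key

/-- **The fat-minority stub on the dominant-relay class.**  If `a₀ ∈ A` is `θ`-dominant for the
observer `o ∉ A` (`P(o ↔ A, o ↮ a₀) ≤ θ P(o ↮ a₀)`, `0 ≤ θ`, `2θ < 1`) and `P(a ↮ a') ≤ η` on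
`A`, then `(1 − 2θ) · P(1 ≤ N ∧ 2N ≤ |A|) ≤ 2η + 4θη + 2θ · P(o ↮ A)`.
[cite: VandenbergHaggstromKahn2005, Thm. 1.4 (p. 7)] -/
theorem fatMinority_dominantRelay {n : ℕ} (w : Sym2 (Fin n) → unitInterval) (A : Finset (Fin n))
    (o a₀ : Fin n) (η θ : ℝ) (hθ : 0 ≤ θ) (ha₀ : a₀ ∈ A) (hoA : o ∉ A)
    (hdom : (prodBernoulli w).real ((openConn o a₀ : Set (BondConfig (Fin n)))ᶜ ∩
        (⋃ a' ∈ A, (openConn o a' : Set (BondConfig (Fin n))))) ≤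
      θ * (prodBernoulli w).real (openConn o a₀ : Set (BondConfig (Fin n)))ᶜ)
    (hpair : ∀ a ∈ A, ∀ a' ∈ A, (prodBernoulli w).real (openConn a a' : Set (BondConfig (Fin n)))ᶜ ≤ η) :
    (1 - 2 * θ) * (prodBernoulli w).real {ω : BondConfig (Fin n) |
        0 < (A.filter fun a => ω ∈ openConn o a).card ∧
          2 * (A.filter fun a => ω ∈ openConn o a).card ≤ A.card} ≤
      2 * η + 4 * θ * η +
        2 * θ * (prodBernoulli w).real (⋃ a' ∈ A, (openConn o a' : Set (BondConfig (Fin n))))ᶜ := by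
  have hmeas : ∀ s : Set (BondConfig (Fin n)), MeasurableSet s :=
    fun _ => MeasurableSet.of_discrete
  have hne : o ≠ a₀ := fun h => hoA (h ▸ ha₀)
  set P := prodBernoulli w with hP
  set D : Set (BondConfig (Fin n)) := (openConn o a₀ : Set (BondConfig (Fin n)))ᶜ with hD
  set U : Set (BondConfig (Fin n)) := ⋃ a' ∈ A, (openConn o a' : Set (BondConfig (Fin n))) with hU
  set F : Set (BondConfig (Fin n)) := {ω : BondConfig (Fin n) |
      0 < (A.filter fun a => ω ∈ openConn o a).card ∧
        2 * (A.filter fun a => ω ∈ openConn o a).card ≤ A.card} with hFdef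
  set m : ℝ := (A.card : ℝ) with hm
  have hmpos : 0 < m := by rw [hm]; exact_mod_cast Finset.card_pos.2 ⟨a₀, ha₀⟩
  have hη0 : 0 ≤ η := le_trans measureReal_nonneg (hpair a₀ ha₀ a₀ ha₀)
  -- S1/S2: BHK summed over `a`, and dominance: X ≤ θ Z
  set X : ℝ := ∑ a ∈ A, P.real (D ∩ (U ∩ (openConn a₀ a : Set (BondConfig (Fin n))))) with hX
  set Z : ℝ := ∑ a ∈ A, P.real (D ∩ (openConn a₀ a : Set (BondConfig (Fin n)))) with hZ
  have hX0 : 0 ≤ X := Finset.sum_nonneg fun a _ => measureReal_nonneg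
  have hZ0 : 0 ≤ Z := Finset.sum_nonneg fun a _ => measureReal_nonneg
  have hS1 : P.real D * X ≤ P.real (D ∩ U) * Z := by
    rw [hX, hZ, Finset.mul_sum, Finset.mul_sum]
    exact Finset.sum_le_sum fun a _ => reachSet_openConn_negCorr w A o a₀ a hne
  have hS2 : X ≤ θ * Z := by
    rcases (measureReal_nonneg : 0 ≤ P.real D).eq_or_lt with hD0 | hDpos
    · have hXle : X ≤ ∑ a ∈ A, P.real D :=
        Finset.sum_le_sum fun a _ => measureReal_mono Set.inter_subset_left (measure_ne_top _ _)
      rw [Finset.sum_const, nsmul_eq_mul, ← hD0, mul_zero] at hXle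
      exact hXle.trans (mul_nonneg hθ hZ0)
    · have h1 : P.real D * X ≤ P.real D * (θ * Z) := by
        calc P.real D * X ≤ P.real (D ∩ U) * Z := hS1
          _ ≤ θ * P.real D * Z := mul_le_mul_of_nonneg_right hdom hZ0
          _ = P.real D * (θ * Z) := by ring
      exact le_of_mul_le_mul_left h1 hDpos
  -- S3: Z ≤ Σ_a P(o ↮ a)
  have hS3 : Z ≤ ∑ a ∈ A, P.real (openConn o a : Set (BondConfig (Fin n)))ᶜ := by
    refine Finset.sum_le_sum fun a _ => measureReal_mono (fun ω hω => ?_) (measure_ne_top _ _)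
    obtain ⟨hoa₀, ha₀a⟩ := hω
    intro hoa
    have h1 : (openGraph ω).Reachable o a := hoa
    have h2 : (openGraph ω).Reachable a₀ a := ha₀a
    exact hoa₀ (h1.trans h2.symm)
  -- S4: Σ_a P(o ↮ a) ≤ m (P(Uᶜ) + P(F) + 2η)
  have hS4 : ∑ a ∈ A, P.real (openConn o a : Set (BondConfig (Fin n)))ᶜ ≤
      m * (P.real Uᶜ + P.real F + 2 * η) := by
    have hper : ∀ a ∈ A, P.real (openConn o a : Set (BondConfig (Fin n)))ᶜ ≤
        P.real Uᶜ + P.real F + 2 * η := by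
      intro a ha
      -- the tail piece `{m/2 ≤ N} ∩ {o ↮ a}` costs `≤ 2η` (Harris–Markov)
      have hAb : ∀ a' ∈ A, 1 - η ≤ P.real (openConn a' a : Set (BondConfig (Fin n))) := by
        intro a' ha'
        have := hpair a' ha' a ha
        rw [probReal_compl_eq_one_sub (hmeas _)] at this
        linarith
      have htail := nhlts_tail w A o a η (m / 2) hAb
      have hEN : ∑ a' ∈ A, P.real (openConn o a' : Set (BondConfig (Fin n))) ≤ m := by
        calc ∑ a' ∈ A, P.real (openConn o a' : Set (BondConfig (Fin n)))
            ≤ ∑ a' ∈ A, (1 : ℝ) := Finset.sum_le_sum fun _ _ => measureReal_le_one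
          _ = m := by simp [hm]
      set T : Set (BondConfig (Fin n)) :=
        {ω | m / 2 ≤ ((A.filter fun a' => ω ∈ openConn o a').card : ℝ)} ∩
          (openConn o a : Set (BondConfig (Fin n)))ᶜ with hT
      have hT2 : P.real T ≤ 2 * η := by
        have h2 : m / 2 * P.real T ≤ m / 2 * (2 * η) := by
          calc m / 2 * P.real T
              ≤ η * ∑ a' ∈ A, P.real (openConn o a' : Set (BondConfig (Fin n))) := htail
            _ ≤ η * m := mul_le_mul_of_nonneg_left hEN hη0
            _ = m / 2 * (2 * η) := by ring
        exact le_of_mul_le_mul_left h2 (by positivity)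
      have hcov : (openConn o a : Set (BondConfig (Fin n)))ᶜ ⊆ (Uᶜ ∪ F) ∪ T := by
        intro ω hω
        by_cases hωU : ω ∈ U
        · obtain ⟨a', ha', hωa'⟩ := Set.mem_iUnion₂.1 hωU
          have h1 : 0 < (A.filter fun a => ω ∈ openConn o a).card :=
            Finset.card_pos.2 ⟨a', Finset.mem_filter.2 ⟨ha', hωa'⟩⟩
          by_cases h2 : 2 * (A.filter fun a => ω ∈ openConn o a).card ≤ A.card
          · exact Or.inl (Or.inr ⟨h1, h2⟩)
          · refine Or.inr ⟨?_, hω⟩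
            change m / 2 ≤ ((A.filter fun a' => ω ∈ openConn o a').card : ℝ)
            have h3 : (A.card : ℝ) < 2 * ((A.filter fun a => ω ∈ openConn o a).card : ℝ) := by
              exact_mod_cast lt_of_not_ge h2
            rw [hm]; linarith
        · exact Or.inl (Or.inl hωU)
      calc P.real (openConn o a : Set (BondConfig (Fin n)))ᶜ
          ≤ P.real ((Uᶜ ∪ F) ∪ T) := measureReal_mono hcov (measure_ne_top _ _)
        _ ≤ P.real (Uᶜ ∪ F) + P.real T := measureReal_union_le _ _
        _ ≤ P.real Uᶜ + P.real F + P.real T := by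
            have := measureReal_union_le (μ := P) Uᶜ F
            linarith
        _ ≤ P.real Uᶜ + P.real F + 2 * η := by linarith
    calc ∑ a ∈ A, P.real (openConn o a : Set (BondConfig (Fin n)))ᶜ
        ≤ ∑ a ∈ A, (P.real Uᶜ + P.real F + 2 * η) := Finset.sum_le_sum hper
      _ = m * (P.real Uᶜ + P.real F + 2 * η) := by rw [Finset.sum_const, nsmul_eq_mul, hm]
  -- S5: Markov: (m/2) P(D ∩ U ∩ Maj) ≤ X
  set Maj : Set (BondConfig (Fin n)) :=
    {ω | A.card < 2 * (A.filter fun a => ω ∈ openConn a₀ a).card} with hMaj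
  have hS5 : m / 2 * P.real ((D ∩ U) ∩ Maj) ≤ X := by
    have hc := halfLeSevenForms_mul_measureReal_le_sum_inter P A
      (fun a => (openConn a₀ a : Set (BondConfig (Fin n)))) (fun _ _ => hmeas _) (hmeas _)
      (m / 2) (S := (D ∩ U) ∩ Maj) ?_
    · refine hc.trans (Finset.sum_le_sum fun a _ => measureReal_mono (fun ω hω => ?_)
        (measure_ne_top _ _))
      exact ⟨hω.1.1.1, hω.1.1.2, hω.2⟩
    intro ω hω
    have hind : ∀ a ∈ A, (openConn a₀ a : Set (BondConfig (Fin n))).indicator (fun _ => (1 : ℝ)) ω =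
        if ω ∈ (openConn a₀ a : Set (BondConfig (Fin n))) then (1 : ℝ) else 0 := by
      intro a _
      by_cases h' : ω ∈ (openConn a₀ a : Set (BondConfig (Fin n)))
      · rw [if_pos h', Set.indicator_of_mem h']
      · rw [if_neg h', Set.indicator_of_notMem h']
    rw [Finset.sum_congr rfl hind, Finset.sum_boole]
    have hmaj : A.card < 2 * (A.filter fun a => ω ∈ openConn a₀ a).card := hω.2
    have hmaj' : m < 2 * ((A.filter fun a => ω ∈ openConn a₀ a).card : ℝ) := by
      rw [hm]; exact_mod_cast hmaj
    linarith
  -- S6: the complement of `Maj`: `a₀` misses at least half of the relays, cost `2η`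
  set S' : Set (BondConfig (Fin n)) :=
    {ω | 2 * (A.filter fun a => ω ∈ openConn a₀ a).card ≤ A.card} with hS'
  have hS6 : P.real S' ≤ 2 * η := by
    have hc := halfLeSevenForms_mul_measureReal_le_sum_inter P A
      (fun a => (openConn a₀ a : Set (BondConfig (Fin n)))ᶜ) (fun _ _ => hmeas _) (hmeas S')
      (m / 2) ?_
    · have hsum : ∑ a ∈ A, P.real (S' ∩ (openConn a₀ a : Set (BondConfig (Fin n)))ᶜ) ≤ m * η := by
        calc ∑ a ∈ A, P.real (S' ∩ (openConn a₀ a : Set (BondConfig (Fin n)))ᶜ)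
            ≤ ∑ a ∈ A, η := Finset.sum_le_sum fun a ha =>
              (measureReal_mono Set.inter_subset_right (measure_ne_top _ _)).trans (hpair a₀ ha₀ a ha)
          _ = m * η := by rw [Finset.sum_const, nsmul_eq_mul, hm]
      have h2 : m / 2 * P.real S' ≤ m / 2 * (2 * η) := by
        calc m / 2 * P.real S' ≤ m * η := hc.trans hsum
          _ = m / 2 * (2 * η) := by ring
      exact le_of_mul_le_mul_left h2 (by positivity)
    intro ω hω
    have hind : ∀ a ∈ A,
        ((openConn a₀ a : Set (BondConfig (Fin n)))ᶜ).indicator (fun _ => (1 : ℝ)) ω =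
          if ¬ ω ∈ (openConn a₀ a : Set (BondConfig (Fin n))) then (1 : ℝ) else 0 := by
      intro a _
      by_cases h' : ω ∈ (openConn a₀ a : Set (BondConfig (Fin n)))
      · rw [if_neg (not_not.2 h'), Set.indicator_of_notMem (Set.notMem_compl_iff.2 h')]
      · rw [if_pos h', Set.indicator_of_mem (show ω ∈ (openConn a₀ a : Set (BondConfig (Fin n)))ᶜ
          from h')]
    rw [Finset.sum_congr rfl hind, Finset.sum_boole]
    have hsplit := Finset.card_filter_add_card_filter_not (s := A)
      (fun a => ω ∈ (openConn a₀ a : Set (BondConfig (Fin n))))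
    have hcast : ((A.filter fun a => ω ∈ (openConn a₀ a : Set (BondConfig (Fin n)))).card : ℝ) +
        ((A.filter fun a => ¬ ω ∈ (openConn a₀ a : Set (BondConfig (Fin n)))).card : ℝ) = m := by
      rw [hm]; exact_mod_cast hsplit
    have hω' : 2 * ((A.filter fun a => ω ∈ (openConn a₀ a : Set (BondConfig (Fin n)))).card : ℝ) ≤ m := by
      rw [hm]; exact_mod_cast hω
    linarith
  -- cover: F ⊆ S' ∪ (D ∩ U ∩ Maj)
  have hcovF : F ⊆ S' ∪ ((D ∩ U) ∩ Maj) := by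
    intro ω hω
    obtain ⟨hpos, hmin⟩ := hω
    by_cases hmaj : A.card < 2 * (A.filter fun a => ω ∈ openConn a₀ a).card
    · right
      refine ⟨⟨fun hoa₀ => ?_, ?_⟩, hmaj⟩
      · -- `o ↔ a₀` would put the majority inside `C(o)`
        have hsub : (A.filter fun a => ω ∈ openConn a₀ a) ⊆ (A.filter fun a => ω ∈ openConn o a) := by
          intro a ha
          rw [Finset.mem_filter] at ha ⊢
          have h1 : (openGraph ω).Reachable o a₀ := hoa₀
          have h2 : (openGraph ω).Reachable a₀ a := ha.2
          exact ⟨ha.1, h1.trans h2⟩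
        have := Finset.card_le_card hsub
        omega
      · obtain ⟨a, ha⟩ := Finset.card_pos.1 hpos
        rw [Finset.mem_filter] at ha
        exact Set.mem_biUnion (Finset.mem_coe.2 ha.1) ha.2
    · left
      change 2 * (A.filter fun a => ω ∈ openConn a₀ a).card ≤ A.card
      omega
  -- S7: assemble
  have hF_le : P.real F ≤ 2 * η + P.real ((D ∩ U) ∩ Maj) :=
    calc P.real F ≤ P.real (S' ∪ ((D ∩ U) ∩ Maj)) := measureReal_mono hcovF (measure_ne_top _ _)
      _ ≤ P.real S' + P.real ((D ∩ U) ∩ Maj) := measureReal_union_le _ _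
      _ ≤ 2 * η + P.real ((D ∩ U) ∩ Maj) := by linarith
  have hMaj_le : m / 2 * P.real ((D ∩ U) ∩ Maj) ≤ θ * (m * (P.real Uᶜ + P.real F + 2 * η)) :=
    calc m / 2 * P.real ((D ∩ U) ∩ Maj) ≤ X := hS5
      _ ≤ θ * Z := hS2
      _ ≤ θ * ∑ a ∈ A, P.real (openConn o a : Set (BondConfig (Fin n)))ᶜ :=
          mul_le_mul_of_nonneg_left hS3 hθ
      _ ≤ θ * (m * (P.real Uᶜ + P.real F + 2 * η)) := mul_le_mul_of_nonneg_left hS4 hθ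
  have hMaj_le' : P.real ((D ∩ U) ∩ Maj) ≤ 2 * θ * (P.real Uᶜ + P.real F + 2 * η) := by
    have h2 : m / 2 * P.real ((D ∩ U) ∩ Maj) ≤ m / 2 * (2 * θ * (P.real Uᶜ + P.real F + 2 * η)) :=
      calc m / 2 * P.real ((D ∩ U) ∩ Maj) ≤ θ * (m * (P.real Uᶜ + P.real F + 2 * η)) := hMaj_le
        _ = m / 2 * (2 * θ * (P.real Uᶜ + P.real F + 2 * η)) := by ring
    exact le_of_mul_le_mul_left h2 (by positivity)
  nlinarith [hF_le, hMaj_le', measureReal_nonneg (μ := P) (s := Uᶜ), measureReal_nonneg (μ := P) (s := F)]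

/-- **Dominant relay, `θ = 1/4`:** if `4 · P(o ↔ A, o ↮ a₀) ≤ P(o ↮ a₀)` for some `a₀ ∈ A`
(`o ∉ A`) and `P(a ↮ a') ≤ η` on `A`, then for every `d₀`,
`P(d₀ < N ∧ 2N ≤ |A|) ≤ 6η + P(o ↮ A)` — the registered stub with `C = 6` on the dominant-relay
class. [cite: VandenbergHaggstromKahn2005, Thm. 1.4 (p. 7)] -/
theorem fatMinority_dominantRelay_quarter {n : ℕ} (w : Sym2 (Fin n) → unitInterval)
    (A : Finset (Fin n)) (o a₀ : Fin n) (d₀ : ℕ) (η : ℝ) (ha₀ : a₀ ∈ A) (hoA : o ∉ A)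
    (hdom : 4 * (prodBernoulli w).real ((openConn o a₀ : Set (BondConfig (Fin n)))ᶜ ∩
        (⋃ a' ∈ A, (openConn o a' : Set (BondConfig (Fin n))))) ≤
      (prodBernoulli w).real (openConn o a₀ : Set (BondConfig (Fin n)))ᶜ)
    (hpair : ∀ a ∈ A, ∀ a' ∈ A, (prodBernoulli w).real (openConn a a' : Set (BondConfig (Fin n)))ᶜ ≤ η) :
    (prodBernoulli w).real {ω : BondConfig (Fin n) |
        d₀ < (A.filter fun a => ω ∈ openConn o a).card ∧
          2 * (A.filter fun a => ω ∈ openConn o a).card ≤ A.card} ≤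
      6 * η + (prodBernoulli w).real (⋃ a' ∈ A, (openConn o a' : Set (BondConfig (Fin n))))ᶜ := by
  have h := fatMinority_dominantRelay w A o a₀ η (1 / 4) (by norm_num) ha₀ hoA (by linarith) hpair
  have hmono : (prodBernoulli w).real {ω : BondConfig (Fin n) |
        d₀ < (A.filter fun a => ω ∈ openConn o a).card ∧
          2 * (A.filter fun a => ω ∈ openConn o a).card ≤ A.card} ≤
      (prodBernoulli w).real {ω : BondConfig (Fin n) |
        0 < (A.filter fun a => ω ∈ openConn o a).card ∧
          2 * (A.filter fun a => ω ∈ openConn o a).card ≤ A.card} :=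
    measureReal_mono (fun ω hω => ⟨lt_of_le_of_lt (Nat.zero_le _) hω.1, hω.2⟩) (measure_ne_top _ _)
  linarith

end Summit.CriticalPhenomena.PercolationContinuityZ3.Theorems

end
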